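import Mathlib
import Summits.RiemannHypothesis.RiemannHypothesis.Theorems.WeilGroundStateGroundStatesConvergeToXiStubPointwiseOfWeak
import Literature.NumberTheory.LFunctions.WeilExplicit
import Literature.NumberTheory.LFunctions.WeilGroundState
import Literature.NumberTheory.LFunctions.WeilMellinInversion

/-!
# `GroundStatesConvergeToXi`, line `Sketch` — stub `stub_weakLimit_mellin_pointwise` (M1)

Crux item `stmt-RiemannHypothesis-1527` (route `WeilGroundState`).  The MELLIN side of the
weak-limit programme for a GENERAL limit `v` (RH-free); the landed `stub_pointwise_of_weak` is the
special case `v = Φ = 2Ψ(2·)`, `v̂ = ξ`.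

Let `u_k` be ground states (`IsWeilGroundState (a k) (u k)`) and `c_k` scalars such that `c_k u_k`
is TIGHT in every weighted `L¹(e^{b|t|} dt)`, `b < 1/2`, and converges WEAKLY (against smooth
compactly supported test functions) to an a.e.-strongly measurable `v` with
`∫ ‖v(t)‖ e^{b|t|} dt < ∞` for every `b < 1/2`.  Then, with `v̂ = weilMellin v`,
`v̂(s) = ∫ v(t) e^{(s - 1/2)t} dt`:

* (i) `v̂` is holomorphic on the open strip `{0 < Re s < 1}`: for `s₀` in the strip put
  `s₀' = |Re s₀ − 1/2| < 1/2`, choose `s₀' < b < 1/2` and a radius `r > 0` with `s₀' + 2r = b`; on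
  the ball `‖s − s₀‖ < r` the derivative of the integrand is dominated by
  `‖v(t)‖ |t| e^{(s₀'+r)|t|} ≤ r⁻¹ ‖v(t)‖ e^{b|t|}` (`|t| ≤ r⁻¹ e^{r|t|}`), which is integrable, so
  one may differentiate under the integral sign (`hasDerivAt_integral_of_dominated_loc_of_deriv_le`;
  the pattern of `momentsOfStrip_hasDerivAt`, localised to the strip).
* (ii) `c_k û_k(σ) → v̂(σ)` for every real `σ ∈ (0, 1)`, by the ε/2 argument of
  `stub_pointwise_of_weak` with `Φ` replaced by `v`: put `s₀ = |σ − 1/2| < b := (s₀ + 1/2)/2 < 1/2`,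
  let `χ_R` be a smooth bump equal to `1` on `[−R, R]` (`ContDiffBump`) and split
  `e^{(σ−1/2)t} = χ_R e^{(σ−1/2)t} + (1 − χ_R) e^{(σ−1/2)t}`.  The first piece is a Weil test
  function, so its pairing with `c_k u_k` tends to its pairing with `v` (weak convergence); the
  second is `≤ e^{−(b−s₀)R} e^{b|t|}`, so its pairings with `c_k u_k` and with `v` are
  `≤ e^{−(b−s₀)R} M_b` and `≤ e^{−(b−s₀)R} ∫ ‖v‖ e^{b|t|}` uniformly in `k`.  Choose `R`, then `k`.

Mathlib (`ContDiffBump`, Bochner integral, differentiation under the integral sign) + the tree's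
`WeilExplicit` / `WeilGroundState` / `WeilMellinInversion` API and the public helpers
`stub_pointwise_of_weak_*` of the template file only; no named fact is used; no definitions.
Helper file (`--supports`), namespace `…Theorems.GroundStatesConvergeToXi`; all helpers are
prefixed `wlmp_`; the curried forms `differentiableOn_weilMellin_of_weighted` and
`tendsto_weilMellin_of_tight_weak` are exported for the consumer `stub_weakLimit_mellin_locallyUniform`.
-/

set_option linter.dupNamespace false

noncomputable section

open MeasureTheory Complex Filter Set
open scoped Real Topology ContDiff

namespace Summit.RiemannHypothesis.RiemannHypothesis.Theorems.GroundStatesConvergeToXi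

open Literature.NumberTheory.LFunctions

/-! ### Auxiliary estimates for a complex point `s` -/

/-- The modulus of the weight of `weilMellin` at a complex point:
`|e^{(s-1/2)t}| = e^{(Re s - 1/2)t}`. [folklore] -/
theorem wlmp_norm_cexp (s : ℂ) (t : ℝ) :
    ‖cexp ((s - 1 / 2) * ↑t)‖ = Real.exp ((s.re - 1 / 2) * t) := by
  rw [Complex.norm_exp]
  congr 1
  simp [sub_re, mul_re]

/-- `|e^{(s-1/2)t}| ≤ e^{b|t|}` whenever `|Re s - 1/2| ≤ b`. [folklore] -/
theorem wlmp_norm_cexp_le {s : ℂ} {b : ℝ} (hb : |s.re - 1 / 2| ≤ b) (t : ℝ) :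
    ‖cexp ((s - 1 / 2) * ↑t)‖ ≤ Real.exp (b * |t|) := by
  rw [wlmp_norm_cexp, Real.exp_le_exp]
  calc (s.re - 1 / 2) * t ≤ |(s.re - 1 / 2) * t| := le_abs_self _
    _ = |s.re - 1 / 2| * |t| := abs_mul _ _
    _ ≤ b * |t| := mul_le_mul_of_nonneg_right hb (abs_nonneg _)

/-! ### (i) Holomorphy of `v̂` on the open strip -/

/-- **Differentiation under the integral sign, localised to the strip.** If `v` is a.e.-strongly
measurable with `∫ ‖v(t)‖ e^{b|t|} dt < ∞` for every `b < 1/2`, then at every `s₀` with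
`0 < Re s₀ < 1` the transform `v̂ = weilMellin v` has the complex derivative
`∫ v(t) t e^{(s₀-1/2)t} dt`: with `s₀' = |Re s₀ − 1/2| < b := (s₀' + 1/2)/2 < 1/2` and
`r = (b − s₀')/2`, the derivative of the integrand is dominated on the ball `‖s − s₀‖ < r` by
`r⁻¹ ‖v(t)‖ e^{b|t|}`. [folklore] -/
theorem wlmp_hasDerivAt_weilMellin {v : ℝ → ℂ} (hv : AEStronglyMeasurable v volume)
    (hM : ∀ b : ℝ, b < 1 / 2 → Integrable (fun t : ℝ => ‖v t‖ * Real.exp (b * |t|)))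
    {s₀ : ℂ} (h0 : 0 < s₀.re) (h1 : s₀.re < 1) :
    HasDerivAt (weilMellin v) (∫ t : ℝ, v t * (t * cexp ((s₀ - 1 / 2) * t))) s₀ := by
  -- adapted from `momentsOfStrip_hasDerivAt` / `IsWeilGroundState.hasDerivAt_weilMellin`
  set s₀' : ℝ := |s₀.re - 1 / 2| with hs₀'
  have hs₀'lt : s₀' < 1 / 2 := by
    rw [hs₀', abs_lt]; constructor <;> linarith
  set b : ℝ := (s₀' + 1 / 2) / 2 with hb
  have hb2 : b < 1 / 2 := by rw [hb]; linarith
  have hsb : s₀' < b := by rw [hb]; linarith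
  obtain ⟨r, hr0, hrb⟩ : ∃ r : ℝ, 0 < r ∧ s₀' + 2 * r = b :=
    ⟨(b - s₀') / 2, by linarith, by ring⟩
  have hF_meas : ∀ᶠ s in 𝓝 s₀,
      AEStronglyMeasurable (fun t : ℝ => v t * cexp ((s - 1 / 2) * t)) volume :=
    Eventually.of_forall fun s =>
      hv.mul (by fun_prop : Continuous fun t : ℝ => cexp ((s - 1 / 2) * t)).aestronglyMeasurable
  have hF_int : Integrable (fun t : ℝ => v t * cexp ((s₀ - 1 / 2) * t)) :=
    stub_pointwise_of_weak_integrable_mul (K := 1) hv (hM b hb2) (by fun_prop) fun t => by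
      rw [one_mul]; exact wlmp_norm_cexp_le hsb.le t
  have hF'_meas :
      AEStronglyMeasurable (fun t : ℝ => v t * (t * cexp ((s₀ - 1 / 2) * t))) volume :=
    hv.mul
      (by fun_prop : Continuous fun t : ℝ => (t : ℂ) * cexp ((s₀ - 1 / 2) * t)).aestronglyMeasurable
  have h_bound : ∀ᵐ t : ℝ, ∀ s ∈ Metric.ball s₀ r,
      ‖v t * (t * cexp ((s - 1 / 2) * t))‖ ≤ r⁻¹ * (‖v t‖ * Real.exp (b * |t|)) := by
    refine Eventually.of_forall fun t s hs => ?_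
    rw [norm_mul, norm_mul, Complex.norm_real, Real.norm_eq_abs]
    have hs' : ‖s - s₀‖ < r := by rwa [Metric.mem_ball, dist_eq_norm] at hs
    have h3 : |s.re - 1 / 2| ≤ s₀' + r := by
      have e : s.re - 1 / 2 = (s - s₀).re + (s₀.re - 1 / 2) := by simp
      rw [e]
      refine (abs_add_le _ _).trans ?_
      linarith [abs_re_le_norm (s - s₀)]
    have h4 : ‖cexp ((s - 1 / 2) * ↑t)‖ ≤ Real.exp ((s₀' + r) * |t|) := wlmp_norm_cexp_le h3 t
    have h5 : |t| ≤ r⁻¹ * Real.exp (r * |t|) := by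
      rw [le_inv_mul_iff₀ hr0]
      linarith [Real.add_one_le_exp (r * |t|)]
    have hexp : Real.exp (r * |t|) * Real.exp ((s₀' + r) * |t|) = Real.exp (b * |t|) := by
      rw [← Real.exp_add, ← hrb]
      ring_nf
    calc ‖v t‖ * (|t| * ‖cexp ((s - 1 / 2) * ↑t)‖)
        ≤ ‖v t‖ * ((r⁻¹ * Real.exp (r * |t|)) * Real.exp ((s₀' + r) * |t|)) :=
          mul_le_mul_of_nonneg_left
            (mul_le_mul h5 h4 (norm_nonneg _) (by positivity)) (norm_nonneg _)
      _ = r⁻¹ * (‖v t‖ * Real.exp (b * |t|)) := by rw [← hexp]; ring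
  have bound_integrable : Integrable fun t : ℝ => r⁻¹ * (‖v t‖ * Real.exp (b * |t|)) :=
    (hM b hb2).const_mul _
  have h_diff : ∀ᵐ t : ℝ, ∀ s ∈ Metric.ball s₀ r,
      HasDerivAt (fun s : ℂ => v t * cexp ((s - 1 / 2) * t))
        (v t * (t * cexp ((s - 1 / 2) * t))) s :=
    Eventually.of_forall fun t s _ => hasDerivAt_weilIntegrand v t s
  exact (hasDerivAt_integral_of_dominated_loc_of_deriv_le (Metric.ball_mem_nhds s₀ hr0)
    hF_meas hF_int hF'_meas h_bound bound_integrable h_diff).2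

/-- **(i) Holomorphy on the strip.** If `v` is a.e.-strongly measurable and
`∫ ‖v(t)‖ e^{b|t|} dt < ∞` for every `b < 1/2`, then `v̂ = weilMellin v` is complex differentiable
on the open critical strip `{0 < Re s < 1}` (`wlmp_hasDerivAt_weilMellin`). [folklore] -/
theorem differentiableOn_weilMellin_of_weighted {v : ℝ → ℂ} (hv : AEStronglyMeasurable v volume)
    (hM : ∀ b : ℝ, b < 1 / 2 → Integrable (fun t : ℝ => ‖v t‖ * Real.exp (b * |t|))) :
    DifferentiableOn ℂ (weilMellin v) {s : ℂ | 0 < s.re ∧ s.re < 1} := fun _ hs =>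
  (wlmp_hasDerivAt_weilMellin hv hM hs.1 hs.2).differentiableAt.differentiableWithinAt

/-! ### (ii) Pointwise convergence on `(0, 1)` -/

/-- **(ii) Weak ⇒ pointwise, general limit (RH-free).** For ground states `u_k` and scalars `c_k`:
TIGHTNESS of `c_k u_k` in every weighted `L¹(e^{b|t|} dt)`, `b < 1/2`, plus WEAK convergence
against test functions to an a.e.-strongly measurable `v` with `∫ ‖v‖ e^{b|t|} < ∞` for all
`b < 1/2` give `c_k û_k(σ) → v̂(σ)` at every real `σ ∈ (0, 1)`: split
`e^{(σ−1/2)t} = χ_R e^{(σ−1/2)t} + (1 − χ_R) e^{(σ−1/2)t}` with a smooth cutoff `χ_R`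
(`ContDiffBump`); the first pairing converges (a test function), the second is
`≤ e^{-(b−|σ−1/2|)R} (M_b + ∫‖v‖e^{b|t|})` uniformly in `k` for `b = (|σ − 1/2| + 1/2)/2`
(the proof of `stub_pointwise_of_weak` with `Φ` replaced by `v`). [folklore] -/
theorem tendsto_weilMellin_of_tight_weak
    {a : ℕ → ℝ} {u : ℕ → ℝ → ℂ} {c : ℕ → ℂ} {v : ℝ → ℂ}
    (hu : ∀ k, IsWeilGroundState (a k) (u k))
    (htight : ∀ b : ℝ, b < 1 / 2 → ∃ M : ℝ, ∀ k, ∫ t, ‖c k * u k t‖ * Real.exp (b * |t|) ≤ M)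
    (hv : AEStronglyMeasurable v volume)
    (hvI : ∀ b : ℝ, b < 1 / 2 → Integrable (fun t : ℝ => ‖v t‖ * Real.exp (b * |t|)))
    (hweak : ∀ g : ℝ → ℂ, IsWeilTest g →
      Tendsto (fun k => ∫ t, c k * u k t * g t) atTop (𝓝 (∫ t, v t * g t)))
    (σ : ℝ) (hσ : σ ∈ Ioo (0 : ℝ) 1) :
    Tendsto (fun k => c k * weilMellin (u k) σ) atTop (𝓝 (weilMellin v σ)) := by
  -- adapted from `stub_pointwise_of_weak` (the case `v = Φ`)
  obtain ⟨hσ0, hσ1⟩ := hσ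
  -- exponents
  set s₀ : ℝ := |σ - 1 / 2| with hs₀
  have hs₀lt : s₀ < 1 / 2 := by
    rw [hs₀, abs_lt]; constructor <;> linarith
  set b : ℝ := (s₀ + 1 / 2) / 2 with hb
  have hsb : s₀ ≤ b := by rw [hb]; linarith
  have hb2 : b < 1 / 2 := by rw [hb]; linarith
  have hδ : 0 < b - s₀ := by rw [hb]; linarith
  obtain ⟨M, hM⟩ := htight b hb2
  -- the limit-side weighted integrability
  have IΦ : Integrable fun t => ‖v t‖ * Real.exp (b * |t|) := hvI b hb2
  set MΦ : ℝ := ∫ t, ‖v t‖ * Real.exp (b * |t|)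
  have Iv : ∀ k, Integrable fun t => ‖c k * u k t‖ * Real.exp (b * |t|) := fun k =>
    stub_pointwise_of_weak_integrable_weight (hu k) (c k) b
  have hvm : ∀ k, AEStronglyMeasurable (fun t => c k * u k t) volume := fun k =>
    (hu k).memLp.1.const_mul (c k)
  -- the limit `R → ∞` of the tail bound
  have hlim : Tendsto (fun R : ℝ => Real.exp (-((b - s₀) * R)) * (M + MΦ)) atTop (𝓝 0) := by
    have h1 : Tendsto (fun R : ℝ => Real.exp (-((b - s₀) * R))) atTop (𝓝 0) :=
      Real.tendsto_exp_neg_atTop_nhds_zero.comp (tendsto_id.const_mul_atTop hδ)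
    simpa using h1.mul_const (M + MΦ)
  rw [Metric.tendsto_atTop]
  intro ε hε
  obtain ⟨R, hR1, hR⟩ :=
    ((eventually_ge_atTop (1 : ℝ)).and (hlim.eventually (gt_mem_nhds (half_pos hε)))).exists
  have hR0 : 0 < R := lt_of_lt_of_le one_pos hR1
  -- the smooth cutoff and the test function `g_R = χ e^{(σ-1/2)t}`
  let χ : ContDiffBump (0 : ℝ) := ⟨R, R + 1, hR0, by linarith⟩
  have hχ1 : ∀ t : ℝ, |t| ≤ R → χ t = 1 := fun t ht =>
    χ.one_of_mem_closedBall (mem_closedBall_zero_iff.2 (by simpa [Real.norm_eq_abs] using ht))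
  set gR : ℝ → ℂ := fun t => (χ t : ℂ) * cexp ((↑σ - 1 / 2) * ↑t) with hgR
  have hgRtest : IsWeilTest gR := stub_pointwise_of_weak_isWeilTest χ _
  set w₂ : ℝ → ℂ := fun t => (1 - (χ t : ℂ)) * cexp ((↑σ - 1 / 2) * ↑t) with hw₂
  have hw₂c : Continuous w₂ := by
    have := χ.continuous
    rw [hw₂]
    fun_prop
  have hsplit : ∀ t : ℝ, cexp ((↑σ - 1 / 2) * ↑t) = gR t + w₂ t := fun t => by
    simp only [hgR, hw₂]; ring
  -- weight bounds
  have hgRb : ∀ t, ‖gR t‖ ≤ 1 * Real.exp (b * |t|) := fun t => by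
    rw [hgR, norm_mul, Complex.norm_real, Real.norm_of_nonneg χ.nonneg, one_mul]
    calc χ t * ‖cexp ((↑σ - 1 / 2) * ↑t)‖ ≤ 1 * ‖cexp ((↑σ - 1 / 2) * ↑t)‖ :=
          mul_le_mul_of_nonneg_right χ.le_one (norm_nonneg _)
      _ ≤ Real.exp (b * |t|) := by rw [one_mul]; exact stub_pointwise_of_weak_norm_cexp_le hsb t
  have hw₂b : ∀ t, ‖w₂ t‖ ≤ Real.exp (-((b - s₀) * R)) * Real.exp (b * |t|) := fun t =>
    stub_pointwise_of_weak_norm_tail_le χ.nonneg χ.le_one (hχ1 t) hsb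
  -- integrability of the four pairings
  have IvgR : ∀ k, Integrable fun t => c k * u k t * gR t := fun k =>
    stub_pointwise_of_weak_integrable_mul (hvm k) (Iv k) hgRtest.1.continuous hgRb
  have Ivw₂ : ∀ k, Integrable fun t => c k * u k t * w₂ t := fun k =>
    stub_pointwise_of_weak_integrable_mul (hvm k) (Iv k) hw₂c hw₂b
  have IΦgR : Integrable fun t => v t * gR t :=
    stub_pointwise_of_weak_integrable_mul hv IΦ hgRtest.1.continuous hgRb
  have IΦw₂ : Integrable fun t => v t * w₂ t :=
    stub_pointwise_of_weak_integrable_mul hv IΦ hw₂c hw₂b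
  -- decompositions of `c_k û_k(σ)` and `v̂(σ)`
  have hA : ∀ k, c k * weilMellin (u k) σ =
      (∫ t, c k * u k t * gR t) + ∫ t, c k * u k t * w₂ t := fun k => by
    rw [← stub_pointwise_of_weak_integral_split hsplit (IvgR k) (Ivw₂ k), weilMellin,
      ← integral_const_mul]
    simp_rw [mul_assoc]
  have hB : weilMellin v σ = (∫ t, v t * gR t) + ∫ t, v t * w₂ t := by
    rw [← stub_pointwise_of_weak_integral_split hsplit IΦgR IΦw₂]
    simp only [weilMellin]
  -- head: weak convergence against the test function `g_R`
  have hhead := hweak gR hgRtest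
  rw [Metric.tendsto_atTop] at hhead
  obtain ⟨K, hK⟩ := hhead (ε / 2) (half_pos hε)
  refine ⟨K, fun k hk => ?_⟩
  have h1 : ‖(∫ t, c k * u k t * gR t) - ∫ t, v t * gR t‖ < ε / 2 := by
    rw [← dist_eq_norm]; exact hK k hk
  -- tails
  have h2 : ‖∫ t, c k * u k t * w₂ t‖ ≤ Real.exp (-((b - s₀) * R)) * M :=
    (stub_pointwise_of_weak_norm_integral_mul_le (Iv k) hw₂b).trans
      (mul_le_mul_of_nonneg_left (hM k) (Real.exp_pos _).le)
  have h3 : ‖∫ t, v t * w₂ t‖ ≤ Real.exp (-((b - s₀) * R)) * MΦ :=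
    stub_pointwise_of_weak_norm_integral_mul_le IΦ hw₂b
  rw [dist_eq_norm, hA k, hB]
  calc ‖(∫ t, c k * u k t * gR t) + (∫ t, c k * u k t * w₂ t) -
        ((∫ t, v t * gR t) + ∫ t, v t * w₂ t)‖
      = ‖((∫ t, c k * u k t * gR t) - ∫ t, v t * gR t) +
          ((∫ t, c k * u k t * w₂ t) - ∫ t, v t * w₂ t)‖ := by ring_nf
    _ ≤ ‖(∫ t, c k * u k t * gR t) - ∫ t, v t * gR t‖ +
          (‖∫ t, c k * u k t * w₂ t‖ + ‖∫ t, v t * w₂ t‖) :=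
        (norm_add_le _ _).trans (add_le_add le_rfl (norm_sub_le _ _))
    _ < ε / 2 + ε / 2 := by
        refine add_lt_add_of_lt_of_le h1 ?_
        calc ‖∫ t, c k * u k t * w₂ t‖ + ‖∫ t, v t * w₂ t‖
            ≤ Real.exp (-((b - s₀) * R)) * M + Real.exp (-((b - s₀) * R)) * MΦ :=
              add_le_add h2 h3
          _ = Real.exp (-((b - s₀) * R)) * (M + MΦ) := by ring
          _ ≤ ε / 2 := hR.le
    _ = ε := add_halves ε

/-! ### The stub -/

/-- **Stub M1 — `weakLimit_mellin_pointwise` (RH-free).**  For ground states `u_k`, scalars `c_k`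
with `c_k u_k` TIGHT in every `L¹(e^{b|t|})`, `b < 1/2`, converging weakly against tests to an
a.e.-strongly measurable `v` with `∫ ‖v‖ e^{b|t|} < ∞` for all `b < 1/2`: (i) `v̂` is holomorphic
on the open strip (`differentiableOn_weilMellin_of_weighted`: differentiation under the integral
sign, dominated on small balls), and (ii) `c_k û_k(σ) → v̂(σ)` for every real `σ ∈ (0,1)`
(`tendsto_weilMellin_of_tight_weak`: the ε/2 argument of `stub_pointwise_of_weak` with `Φ`
replaced by `v`). [folklore] -/
theorem stub_weakLimit_mellin_pointwise :
    ∀ (a : ℕ → ℝ) (u : ℕ → ℝ → ℂ) (c : ℕ → ℂ) (v : ℝ → ℂ),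
      (∀ k, IsWeilGroundState (a k) (u k)) →
      (∀ b : ℝ, b < 1 / 2 → ∃ M : ℝ, ∀ k, ∫ t, ‖c k * u k t‖ * Real.exp (b * |t|) ≤ M) →
      AEStronglyMeasurable v volume →
      (∀ b : ℝ, b < 1 / 2 → Integrable (fun t : ℝ => ‖v t‖ * Real.exp (b * |t|))) →
      (∀ g : ℝ → ℂ, IsWeilTest g →
        Tendsto (fun k => ∫ t, c k * u k t * g t) atTop (𝓝 (∫ t, v t * g t))) →
      DifferentiableOn ℂ (weilMellin v) {s : ℂ | 0 < s.re ∧ s.re < 1} ∧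
      ∀ σ : ℝ, σ ∈ Ioo (0 : ℝ) 1 →
        Tendsto (fun k => c k * weilMellin (u k) σ) atTop (𝓝 (weilMellin v σ)) :=
  fun _ _ _ _ hu htight hv hvI hweak =>
    ⟨differentiableOn_weilMellin_of_weighted hv hvI,
      tendsto_weilMellin_of_tight_weak hu htight hv hvI hweak⟩

end Summit.RiemannHypothesis.RiemannHypothesis.Theorems.GroundStatesConvergeToXi

end
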